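import Literature.NumberTheory.EllipticCurves.MurtySinhaMultiplicityHeckeProofs
import Literature.NumberTheory.EllipticCurves.MurtySinhaMultiplicityGeometricProofs
import Literature.NumberTheory.EllipticCurves.ModularFormsGamma0Genus
import Literature.NumberTheory.EllipticCurves.ModularCurveGenusIntegralityProofs
import HarnessLib

/-!
# The Eichler–Selberg trace formula on `S₂(Γ₀(N))` at `n = 1`: Schoof–van der Vlugt's Cor. 2.3
# (the Cohen–Oesterlé dimension formula) in weight `2`, trivial character, is the genus formula
# (proofs-only sibling of `HeckeTraceFormulaGL2Level.lean`; theorems only, D-0026)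

Topic `NumberTheory/Automorphic`. The named fact `HeckeTraceFormulaGL2Level N χ k`
(`HeckeTraceFormulaGL2Level.lean`; R. Schoof, M. van der Vlugt, *Hecke operators and the weight
distributions of certain codes*, J. Combin. Theory Ser. A **57** (1991), Thm. 2.2 p. 168) asserts
`Tr(T_n | S_k(Γ₀(N), χ)) = A₁ + A₂ + A₃ + A₄` for all `n ≥ 1`. Its instance `n = 1` is the
dimension formula of Cohen–Oesterlé (loc. cit. Cor. 2.3: "`dim S_k(Γ₀(N), χ) = Tr(T_1) = …`").
This file PROVES that instance for `k = 2`, `χ = 𝟙` and every level `N ≥ 1`: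

  `cuspidalHeckeTrace N 2 1 1 = geometricSide N 1 2 1`      (`traceFormula_two_one_one`),

by evaluating the four vendored terms at `n = 1` —

* `A₁ = ψ(N)/12` (`identityTerm_one_two_one`);
* `A₂ = -ν₂(N)/4 - ν₃(N)/3` (`ellipticTerm_one_two_one`): only `t ∈ {0, ±1}` have `t² < 4`, each
  with the single conductor `f = 1`, the weights `h_w(-4) = 1/2`, `h_w(-3) = 1/3`, the archimedean
  factor `1`, and the local densities `μ(t, 1, 1) = #{x (mod N) : x² - tx + 1 ≡ 0}`
  (`localDensity_one_one_one`; the solutions are units, so `𝟙(x) = 1`), i.e. the numbers `ν₂(N)`,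
  `ν₃(N)` of solutions of `x² + 1 ≡ 0`, `x² ± x + 1 ≡ 0 (mod N)` (the tree's `nu₂`, `nu₃`,
  `ModularCurve.lean`);
* `A₃ = -ν_∞(N)/2` (`hyperbolicTerm_one_two_one`): the single divisor `d = 1 = √n` carries the
  weight `½`, every `c ∣ N` qualifies (`gcd(c, N/c) ∣ N/N_𝟙 = N` and `∣ n/d - d = 0`), and
  `𝟙(y) = 1` for `y ≡ 1 (mod c)`, `y ≡ 1 (mod N/c)` (`crtCharValue_one_one_one`), leaving
  `-½ Σ_{c ∣ N} φ(gcd(c, N/c)) = -ν_∞(N)/2` (the tree's `nuInfty`);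
* `A₄ = 1` (`parabolicTerm_one_two_one`)

— so that `A₁ + A₂ + A₃ + A₄ = ψ(N)/12 - ν₂/4 - ν₃/3 - ν_∞/2 + 1 = g(X₀(N))` by the genus formula
`12 g + 3ν₂ + 4ν₃ + 6ν_∞ = 12 + [SL₂(ℤ) : Γ₀(N)]` (a THEOREM of the tree, `twelve_mul_genusX0_holds`,
`ModularCurveGenusIntegralityProofs`; `ψ(N) = [SL₂(ℤ) : Γ₀(N)]`, `dedekindPsi_eq_gamma0Index_cast`)
(`geometricSide_one_two_one`), while the spectral side is `Tr(T_1 | S₂(N, 𝟙)) = dim S₂(Γ₀(N))`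
(`cuspidalHeckeTrace_one_one`, read off from `MurtySinha.heckeT_gamma0_spectralData` at `m = 0`:
`T_1 = 1` and `S_k(N, 𝟙) ≅ S_k(Γ₀(N))`) `= g(X₀(N))` by the dimension formula
`dim S₂(Γ₀(N)) = g(X₀(N))` (a THEOREM of the tree, `finrank_cuspForm_two_eq_genusX0_holds`,
`ModularFormsGamma0Genus`).

Uses: (i) it discharges the `c = 0` instances (`primePowTrace_two_one_zero`) of the prime-power
trace identities `cuspidalHeckeTrace N 2 1 (p ^ c) = geometricSide N 1 2 (p ^ c)` (`p ∤ N`) that are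
the whole trace-formula input of Murty–Sinha's multiplicity bound
(`murtySinha2009_eigenvalue_multiplicity_weightTwo_of_primePowTraces`) and, through it, of Pasten's
Thm. 7.5 (`pasten_thm_7_5_of_exists_isNewformOf_primePowTraces`); (ii) it is a machine-checked
transcription test of the vendored geometric side (the conventions of `ellipticConductors`,
`weightedClassNumber`, `localDensity`, `crtCharValue`, `parabolicTerm`) against an independently
proved formula, at `n = 1`.

## References

* [SchoofVandervlugt1991] R. Schoof, M. van der Vlugt, JCTA 57 (1991) 163–186: Thm. 2.2 and
  Cor. 2.3, p. 168.
* [DiamondShurman2005] F. Diamond, J. Shurman, *A First Course in Modular Forms*, GTM 228: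
  Thm. 3.1.1 (genus of `X₀(N)`), Thm. 3.5.1 (`dim S₂ = g`), §5.3 (`T_1 = 1`).
* [ShimuraIATAF1971] G. Shimura, *Introduction to the Arithmetic Theory of Automorphic Functions*,
  Prop. 1.40, 1.43.
-/

noncomputable section

open scoped MatrixGroups ModularForm
open CongruenceSubgroup

namespace Literature.NumberTheory.Automorphic.HeckeTraceFormulaGL2Level

open Literature.NumberTheory.EllipticCurves.ModularForms

variable (N : ℕ) [NeZero N]

/-- `ψ(N) = [SL₂(ℤ) : Γ₀(N)]`: `dedekindPsi N = gamma0Index N` over `ℚ` (the real form is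
`ModularForms.dedekindPsi_eq_gamma0Index` of `PastenValuationProductThm75MultiplicityProofs`, the
complex form `gamma0Index_eq_mul_prod_one_add_inv` of `CuspFormSymmSquareLSeries`; restated over `ℚ`
to keep this file's imports light). [folklore] -/
theorem dedekindPsi_eq_gamma0Index_cast : dedekindPsi N = (gamma0Index N : ℚ) := by
  have hN : N ≠ 0 := NeZero.ne N
  have hNprod : (N : ℚ) = ∏ p ∈ N.primeFactors, (p : ℚ) ^ (N.factorization p) := by
    have h := congrArg (Nat.cast (R := ℚ)) (Nat.prod_factorization_pow_eq_self hN)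
    rw [Finsupp.prod, Nat.support_factorization] at h
    push_cast at h
    exact h.symm
  unfold dedekindPsi gamma0Index
  rw [Finsupp.prod, Nat.support_factorization, Nat.cast_prod, hNprod, ← Finset.prod_mul_distrib]
  refine Finset.prod_congr rfl fun p hp ↦ ?_
  have hprime : p.Prime := Nat.prime_of_mem_primeFactors hp
  have hp0 : (p : ℚ) ≠ 0 := Nat.cast_ne_zero.mpr hprime.ne_zero
  have hk : 0 < N.factorization p :=
    Nat.Prime.factorization_pos_of_dvd hprime hN (Nat.dvd_of_mem_primeFactors hp)
  obtain ⟨j, hj⟩ : ∃ j, N.factorization p = j + 1 := ⟨N.factorization p - 1, by omega⟩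
  rw [hj, Nat.add_sub_cancel]
  push_cast
  rw [pow_succ]
  field_simp

/-- A prime not dividing `N`. [folklore] -/
private theorem exists_prime_not_dvd : ∃ p : ℕ, p.Prime ∧ ¬ p ∣ N := by
  obtain ⟨p, hNp, hp⟩ := Nat.exists_infinite_primes (N + 1)
  refine ⟨p, hp, fun h ↦ ?_⟩
  have := Nat.le_of_dvd (Nat.pos_of_ne_zero (NeZero.ne N)) h
  omega

/-- **Spectral side at `n = 1`:** `Tr(T_1 | S_k(N, 𝟙)) = dim S_k(Γ₀(N))` (`T_1 = 1` and
`S_k(N, 𝟙) ≅ S_k(Γ₀(N))`; read off from `MurtySinha.heckeT_gamma0_spectralData` at `m = 0`).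
[folklore] -/
theorem cuspidalHeckeTrace_one_one (k : ℤ) :
    cuspidalHeckeTrace N k 1 1 = (Module.finrank ℂ (CuspForm (Gamma0 N) k) : ℂ) := by
  classical
  obtain ⟨p, hp, hpN⟩ := exists_prime_not_dvd N
  haveI : NeZero p := ⟨hp.ne_zero⟩
  obtain ⟨E, -, -, hdim, htr⟩ := MurtySinha.heckeT_gamma0_spectralData N k p hp hpN
  let P : ℂ → ℕ → ℂ × ℂ := fun x m ↦
    Nat.rec (motive := fun _ ↦ ℂ × ℂ) (1, x) (fun _ ab ↦ (ab.2, x * ab.2 - (p : ℂ) ^ (k - 1) * ab.1)) m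
  have h := htr (fun m x ↦ (P x m).1) (fun _ _ ↦ rfl) (fun _ _ ↦ rfl) (fun _ _ _ ↦ rfl) 0
  rw [pow_zero] at h
  rw [h, hdim]
  refine Finset.sum_congr rfl fun μ _ ↦ ?_
  change _ * (1 : ℂ) = _
  rw [mul_one]

omit [NeZero N] in
/-- **Identity term at `n = 1`, `k = 2`, `χ = 𝟙`:** `A₁ = ψ(N)/12`. [cite: SchoofVandervlugt1991, Thm. 2.2 (A₁) and Cor. 2.3, p. 168] -/
theorem identityTerm_one_two_one : identityTerm N 1 2 1 = (dedekindPsi N : ℂ) / 12 := by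
  unfold identityTerm
  rw [if_pos ⟨1, rfl⟩, Nat.sqrt_one, Nat.cast_one, one_zpow, Nat.cast_one, map_one]
  norm_num
  ring

omit [NeZero N] in
/-- **Parabolic term at `n = 1`, `k = 2`, `χ = 𝟙`:** `A₄ = 1`. [cite: SchoofVandervlugt1991, Thm. 2.2 (A₄) and Cor. 2.3, p. 168] -/
theorem parabolicTerm_one_two_one : parabolicTerm N 1 2 1 = 1 := by
  classical
  unfold parabolicTerm
  rw [if_pos ⟨rfl, rfl⟩, Nat.divisors_one]
  rw [Finset.filter_true_of_mem fun t ht ↦ ?_]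
  · simp
  · rw [Finset.mem_singleton] at ht
    subst ht
    simp

omit [NeZero N] in
/-- `χ(y) = 1` for the number `y` of the hyperbolic term at `n = 1`, trivial character: the
two congruences `y ≡ 1 (mod c)`, `y ≡ 1 (mod N/c)` make `y` a unit modulo `N = c · (N/c)`.
[cite: SchoofVandervlugt1991, Thm. 2.2 (A₃), p. 168] -/
theorem crtCharValue_one_one_one {c e : ℕ} (hce : c * e = N) : crtCharValue N 1 c e 1 1 = 1 := by
  classical
  have key : ∀ y : ℕ, (c : ℤ) ∣ (y : ℤ) - 1 → (e : ℤ) ∣ (y : ℤ) - 1 →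
      (1 : DirichletCharacter ℂ N) (y : ZMod N) = 1 := by
    intro y hyc hye
    have hcop : ∀ d : ℕ, (d : ℤ) ∣ (y : ℤ) - 1 → Nat.Coprime y d := by
      intro d hd
      obtain ⟨m, hm⟩ := hd
      have h : IsCoprime (y : ℤ) (d : ℤ) := ⟨1, -m, by linear_combination hm⟩
      exact Nat.isCoprime_iff_coprime.mp h
    have hyN : Nat.Coprime y N := by
      rw [← hce]
      exact Nat.Coprime.mul_right (hcop c hyc) (hcop e hye)
    exact MulChar.one_apply ((ZMod.isUnit_iff_coprime y N).2 hyN)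
  unfold crtCharValue
  have hex : ∃ y : ℕ, (c : ℤ) ∣ (y : ℤ) - (1 : ℕ) ∧ (e : ℤ) ∣ (y : ℤ) - (1 : ℕ) :=
    ⟨1, by simp, by simp⟩
  rw [dif_pos hex]
  have hs := Nat.find_spec hex
  exact key _ (by simpa using hs.1) (by simpa using hs.2)

/-- **Hyperbolic term at `n = 1`, `k = 2`, `χ = 𝟙`:** `A₃ = -ν_∞(N)/2` with
`ν_∞(N) = Σ_{c ∣ N} φ(gcd(c, N/c))` the number of cusps of `Γ₀(N)` (the tree's `nuInfty`).
[cite: SchoofVandervlugt1991, Thm. 2.2 (A₃) and Cor. 2.3, p. 168] -/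
theorem hyperbolicTerm_one_two_one : hyperbolicTerm N 1 2 1 = -((nuInfty N : ℂ) / 2) := by
  classical
  have hN : N ≠ 0 := NeZero.ne N
  unfold hyperbolicTerm
  have hd : (Nat.divisors 1).filter (fun d ↦ d * d ≤ 1) = {1} := by decide
  rw [hd, Finset.sum_singleton, if_pos rfl, Nat.cast_one, one_zpow, mul_one, Nat.div_one]
  have hcond : (1 : DirichletCharacter ℂ N).conductor = 1 := DirichletCharacter.conductor_one
  rw [hcond, Nat.div_one]
  rw [Finset.filter_true_of_mem fun c hc ↦ ?_]
  · congr 1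
    rw [nuInfty, Nat.cast_sum, Finset.sum_div, Finset.mul_sum]
    refine Finset.sum_congr rfl fun c hc ↦ ?_
    have hcN : c ∣ N := Nat.dvd_of_mem_divisors hc
    rw [crtCharValue_one_one_one N (Nat.mul_div_cancel' hcN)]
    ring
  · refine ⟨(Nat.gcd_dvd_left _ _).trans (Nat.dvd_of_mem_divisors hc), ?_⟩
    simp

/-- The `x (mod N)` with `x² - tx + 1 ≡ 0 (mod N)` are units, so the trivial character takes the
value `1` there, and the root count of the local density at `n = 1`, `f = 1` is the number of
solutions of `x² - tx + 1 = 0` in `ℤ/Nℤ`. [cite: SchoofVandervlugt1991, Thm. 2.2 (μ(t, f, n)), p. 168] -/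
theorem localDensity_one_one_one (t : ℤ) :
    localDensity N 1 t 1 1 = (Nat.card {x : ZMod N // x ^ 2 - (t : ZMod N) * x + 1 = 0} : ℂ) := by
  classical
  have hN : N ≠ 0 := NeZero.ne N
  unfold localDensity
  have hψ : dedekindPsi N ≠ 0 :=
    (lt_of_lt_of_le (by exact_mod_cast Nat.pos_of_ne_zero hN) (MurtySinha.le_dedekindPsi N)).ne'
  rw [Nat.gcd_one_right, Nat.div_one, mul_one, div_self hψ, Rat.cast_one, one_mul]
  -- the casts of the quadratic polynomial
  have hcast : ∀ x : ℕ, (((x : ℤ) ^ 2 - t * x + (1 : ℕ) : ℤ) : ZMod N) =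
      (x : ZMod N) ^ 2 - (t : ZMod N) * (x : ZMod N) + 1 := fun x ↦ by push_cast; ring
  have hiff : ∀ x : ℕ, (N : ℤ) ∣ (x : ℤ) ^ 2 - t * x + (1 : ℕ) ↔
      (x : ZMod N) ^ 2 - (t : ZMod N) * (x : ZMod N) + 1 = 0 := fun x ↦ by
    rw [← hcast, ZMod.intCast_zmod_eq_zero_iff_dvd]
  -- the character values are `1` on the solutions
  have hsum : (∑ x ∈ Finset.range N, if (N : ℤ) ∣ (x : ℤ) ^ 2 - t * x + (1 : ℕ) then
      (1 : DirichletCharacter ℂ N) (x : ZMod N) else 0) =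
      ∑ x ∈ Finset.range N, if (N : ℤ) ∣ (x : ℤ) ^ 2 - t * x + (1 : ℕ) then (1 : ℂ) else 0 := by
    refine Finset.sum_congr rfl fun x _ ↦ ?_
    split_ifs with h
    · refine MulChar.one_apply (IsUnit.of_mul_eq_one ((t : ZMod N) - x) ?_)
      have h' := (hiff x).1 h
      linear_combination -h'
    · rfl
  rw [hsum, Finset.sum_boole, Nat.card_eq_fintype_card, Fintype.card_subtype]
  congr 1
  refine Finset.card_bij (fun x _ ↦ (x : ZMod N)) (fun x hx ↦ ?_) (fun x₁ hx₁ x₂ hx₂ h ↦ ?_)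
    (fun y hy ↦ ?_)
  · rw [Finset.mem_filter] at hx
    exact Finset.mem_filter.2 ⟨Finset.mem_univ _, (hiff x).1 hx.2⟩
  · have h₁ := (Finset.mem_filter.1 hx₁).1
    have h₂ := (Finset.mem_filter.1 hx₂).1
    rw [Finset.mem_range] at h₁ h₂
    have := congrArg ZMod.val h
    rwa [ZMod.val_cast_of_lt h₁, ZMod.val_cast_of_lt h₂] at this
  · refine ⟨y.val, Finset.mem_filter.2 ⟨Finset.mem_range.2 (ZMod.val_lt y), ?_⟩, ZMod.natCast_zmod_val y⟩
    rw [hiff, ZMod.natCast_zmod_val]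
    exact (Finset.mem_filter.1 hy).2

/-- The `t`-range of the elliptic term at `n = 1`: `t² < 4` means `t ∈ {-1, 0, 1}`. [folklore] -/
theorem ellipticRange_one :
    (Finset.Icc (-(2 * (1 : ℕ) : ℤ)) (2 * (1 : ℕ))).filter (fun t : ℤ ↦ t ^ 2 < 4 * ((1 : ℕ) : ℤ)) =
      {-1, 0, 1} := by
  ext t
  simp only [Finset.mem_filter, Finset.mem_Icc, Finset.mem_insert, Finset.mem_singleton]
  push_cast
  constructor
  · rintro ⟨⟨h1, h2⟩, h3⟩
    interval_cases t <;> simp_all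
  · rintro (rfl | rfl | rfl) <;> norm_num

/-- **Elliptic term at `n = 1`, `k = 2`, `χ = 𝟙`:** `A₂ = -ν₂(N)/4 - ν₃(N)/3`, where `ν₂(N)`,
`ν₃(N)` count the solutions of `x² + 1 = 0`, `x² + x + 1 = 0` in `ℤ/Nℤ` (the tree's `nu₂`, `nu₃`):
the three values `t = 0, ±1` carry the single conductor `f = 1`, the weights `h_w(-4) = 1/2`,
`h_w(-3) = 1/3` and the root counts of `x² + 1`, `x² ∓ x + 1`.
[cite: SchoofVandervlugt1991, Thm. 2.2 (A₂) and Cor. 2.3, p. 168] -/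
theorem ellipticTerm_one_two_one :
    ellipticTerm N 1 2 1 = -((nu₂ N : ℂ) / 4 + (nu₃ N : ℂ) / 3) := by
  classical
  unfold ellipticTerm
  rw [ellipticRange_one]
  have hc0 : ellipticConductors 0 1 = {1} := by decide
  have hc1 : ellipticConductors 1 1 = {1} := by decide
  have hcm1 : ellipticConductors (-1) 1 = {1} := by decide
  rw [Finset.sum_insert (by decide), Finset.sum_insert (by decide), Finset.sum_singleton, hc0, hc1, hcm1,
    Finset.sum_singleton, Finset.sum_singleton, Finset.sum_singleton,
    archFactor_two (by norm_num), archFactor_two (by norm_num), archFactor_two (by norm_num),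
    localDensity_one_one_one, localDensity_one_one_one, localDensity_one_one_one]
  -- the weights
  have h4 : ((0 : ℤ) ^ 2 - 4 * (1 : ℕ)) / ((1 : ℕ) : ℤ) ^ 2 = -4 := by norm_num
  have h3 : ((1 : ℤ) ^ 2 - 4 * (1 : ℕ)) / ((1 : ℕ) : ℤ) ^ 2 = -3 := by norm_num
  have h3' : ((-1 : ℤ) ^ 2 - 4 * (1 : ℕ)) / ((1 : ℕ) : ℤ) ^ 2 = -3 := by norm_num
  rw [h4, h3, h3', weightedClassNumber_neg_four, weightedClassNumber_neg_three]
  -- the root counts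
  have e0 : Nat.card {x : ZMod N // x ^ 2 - ((0 : ℤ) : ZMod N) * x + 1 = 0} = nu₂ N := by
    unfold nu₂
    exact Nat.card_congr (Equiv.subtypeEquivRight fun x ↦ by push_cast; ring_nf)
  have e1 : Nat.card {x : ZMod N // x ^ 2 - ((1 : ℤ) : ZMod N) * x + 1 = 0} = nu₃ N := by
    unfold nu₃
    refine Nat.card_congr ((Equiv.neg (ZMod N)).subtypeEquiv fun x ↦ ?_)
    simp only [Equiv.neg_apply, Int.cast_one, one_mul]
    constructor <;> intro h <;> linear_combination h
  have em1 : Nat.card {x : ZMod N // x ^ 2 - ((-1 : ℤ) : ZMod N) * x + 1 = 0} = nu₃ N := by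
    unfold nu₃
    exact Nat.card_congr (Equiv.subtypeEquivRight fun x ↦ by push_cast; ring_nf)
  rw [e0, e1, em1]
  push_cast
  ring

/-- **The geometric side at `n = 1` is the genus of `X₀(N)`:**
`A₁ + A₂ + A₃ + A₄ = ψ(N)/12 - ν₂/4 - ν₃/3 - ν_∞/2 + 1 = g(X₀(N))` (Schoof–van der Vlugt Cor. 2.3 in
weight `2`, trivial character, against the tree's genus formula `12 g + 3ν₂ + 4ν₃ + 6ν_∞ = 12 + μ`,
`twelve_mul_genusX0_holds`). [cite: SchoofVandervlugt1991, Cor. 2.3, p. 168] -/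
theorem geometricSide_one_two_one : geometricSide N 1 2 1 = (genusX0 N : ℂ) := by
  rw [geometricSide, identityTerm_one_two_one, ellipticTerm_one_two_one, hyperbolicTerm_one_two_one,
    parabolicTerm_one_two_one, dedekindPsi_eq_gamma0Index_cast, Rat.cast_natCast]
  have h := twelve_mul_genusX0_holds N
  unfold twelve_mul_genusX0 at h
  have h' : (12 * genusX0 N + 3 * nu₂ N + 4 * nu₃ N + 6 * nuInfty N : ℂ) = 12 + gamma0Index N := by
    exact_mod_cast h
  linear_combination (1 / 12 : ℂ) * h'.symm
  
/-- **The Eichler–Selberg trace formula on `S₂(Γ₀(N))` at `n = 1`** (all `N ≥ 1`): the instance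
`n = 1` of the named fact `HeckeTraceFormulaGL2Level N 1 2` — `Tr(T_1) = dim S₂(Γ₀(N))` equals
`A₁ + A₂ + A₃ + A₄ = g(X₀(N))` — by the tree's dimension formula `dim S₂(Γ₀(N)) = g(X₀(N))`
(`finrank_cuspForm_two_eq_genusX0_holds`). [cite: SchoofVandervlugt1991, Thm. 2.2 and Cor. 2.3, p. 168] -/
theorem traceFormula_two_one_one : cuspidalHeckeTrace N 2 1 1 = geometricSide N 1 2 1 := by
  rw [cuspidalHeckeTrace_one_one, geometricSide_one_two_one]
  have h := finrank_cuspForm_two_eq_genusX0_holds N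
  unfold finrank_cuspForm_two_eq_genusX0 at h
  exact_mod_cast congrArg (Nat.cast (R := ℂ)) h

/-- The `c = 0` instances of the prime-power trace identities
`cuspidalHeckeTrace N 2 1 (p ^ c) = geometricSide N 1 2 (p ^ c)` (the hypothesis shape of
`murtySinha2009_eigenvalue_multiplicity_weightTwo_of_primePowTraces`). [cite: SchoofVandervlugt1991, Thm. 2.2 and Cor. 2.3, p. 168] -/
theorem primePowTrace_two_one_zero (p : ℕ) :
    cuspidalHeckeTrace N 2 1 (p ^ 0) = geometricSide N 1 2 (p ^ 0) := by
  rw [pow_zero]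
  exact traceFormula_two_one_one N

end Literature.NumberTheory.Automorphic.HeckeTraceFormulaGL2Level

end
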